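import Summits.BirchSwinnertonDyer.BirchSwinnertonDyer.Theorems.TeichmullerTwistDescentCells57FromKato
import Summits.BirchSwinnertonDyer.Rank1Residual.Additive.GordTorsionFiveSeven
import HarnessLib

/-!
# Route `TeichmullerTwistDescent`, cruxes PSMU (stmt-BirchSwinnertonDyer-22638) / SCMU57
# (stmt-BirchSwinnertonDyer-22639): the EXACT residual of the `p ∈ {5, 7}` cells granted Kato's fact —
# the Raynaud corner III@5 / II@7 with a `ℚ_p`-rational `p`-torsion point (PS), type II@5 (SC) (`--supports`)

Cell `pub/bsd-wall` (D-0145 line route-BirchSwinnertonDyer-TeichmullerTwistDescent, DRAFT rev 0), seat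
`bsd-line-ttd-p2` (prover 2/2, g0). THEOREMS ONLY (no definition, no named fact, no `sorry`); nothing is
booked, no item is closed, BSD is not proved by this.

`TeichmullerTwistDescentCells57FromKato.lean` (p583513) closed the `p ∈ {5, 7}` on-curve cell at every optimal
curve WITHOUT a `ℚ_p`-rational point of order `p`, granted F″ =
`kato_neron_isIntegral_twistedSymbolSum_of_additive_five_le`. The tree KNOWS where such a point can exist
(Mazur 1977 III §5 Step 1 at `5, 7`, cell `b2b-bsdres` gen 37, `Additive/GordTorsionFiveSeven.lean`):
`P ≠ O`, `p • P = O` in `E(ℚ_p)` at an additive `p ≥ 5` forces `(p = 5 ∧ v₅(Δ_min) ∈ {2, 3}) ∨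
(p = 7 ∧ v₇(Δ_min) = 2)` (`padicValInt_minimalDiscriminantInt_of_prime_zsmul_eq_zero_of_addv`), and on the
(G)-cell `(p = 5 ∧ v₅(Δ_min) = 3) ∨ (p = 7 ∧ v₇(Δ_min) = 2)` (`TypeG.padicValInt_of_prime_zsmul_eq_zero`).
Hence, GRANTED F″:

* `cellPS57_of_kato57_of_corner` — **(PS57) ⟸ its RAYNAUD-CORNER sub-cell**: optimal `W`, `(p, v_p(Δ_min)) ∈
  {(5, 3), (7, 2)}` — Kodaira III at `5` (`e = 4 = p − 1`) / II at `7` (`e = 6 = p − 1`), exactly the corner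
  the route's «why it might fail» names — `(G)`-ordinary, `E[p]` irreducible, WITH a `ℚ_p`-rational point of
  order `p`, lattice-optimal `D` at the conductor level ⟹ `p ∤ c(D)`.
* `cellSC57_of_kato57_of_lowDiscriminant` — **(SC57) ⟸ its sub-cell** `(p, v) ∈ {(5, 2), (5, 3), (7, 2)}`,
  NOT `(G)`-ordinary, with a `ℚ_p`-rational point of order `p` (of these only II@5, `e = 6 ∤ 4`, is
  potentially supersingular; `(5, 3)` and `(7, 2)` have `e ∣ p − 1` and are `(G)`-ordinary once potentially
  good — recorded, not used).
* `principalSeriesOptimalManinUnit_of_cellPS11_of_kato57_of_corner`, `supercuspidalOptimalManinUnitFiveSeven_of_kato57_of_lowDiscriminant`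
  — the cruxes from (PS≥11) [= AKR TDS], F″, Edixhoven's Kodaira fact, Modularity and the two sub-cells.

So, granted print + F″, the whole `p ∈ {5, 7}` content of route TeichmullerTwistDescent is: Manin's `p`-part
at the optimal curves of type III at `5` / II at `7` ((G)-ordinary) and II at `5` (supersingular) that carry
a `ℚ_p`-rational `p`-torsion point (Kosters–Pannekoek: `a₄ ≡ 10 (25)` / `a₆ ≡ 14 (49)`; manin-p1's KP57
census: 49 of 1 159 residue cells with `N ≤ 5·10⁵`). [cite: Mazur1977, Ch. III §5, Step 1, p. 158]
[cite: KostersPannekoek2017, Thm. 1 and Cor. 2] [cite: Kato2004Asterisque, Thm. 9.7 (p. 189)]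
[cite: EdixhovenManin1991, Thm. 3 and Prop. 7]
-/

set_option autoImplicit false
-- single-conjunct summit: `Summit.BirchSwinnertonDyer.BirchSwinnertonDyer.…` repeats the name by design
set_option linter.dupNamespace false

noncomputable section

open scoped Classical

open WeierstrassCurve IsDedekindDomain Rat.HeightOneSpectrum
  Literature.NumberTheory.EllipticCurves Literature.NumberTheory.EllipticCurves.ModularForms
  Literature.NumberTheory.EllipticCurves.Rank1Residual Literature.NumberTheory.DiophantineGeometry
  Summit.BirchSwinnertonDyer.Rank1Residual Summit.BirchSwinnertonDyer.Rank1Residual.Additive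
  Summit.BirchSwinnertonDyer.BirchSwinnertonDyer.Theses.TeichmullerTwistDescent
  Summit.BirchSwinnertonDyer.BirchSwinnertonDyer.Theorems

namespace Summit.BirchSwinnertonDyer.BirchSwinnertonDyer.Theorems.TeichmullerTwistDescent

/-! ### (PS57): only the Raynaud corner with a local `p`-torsion point remains -/

/-- **(PS57) from its Raynaud-corner sub-cell, granted Kato's fact F″.** If `p ∤ c(D)` holds for every
globally minimal `W` with a lattice-optimal conductor-level datum `D`, additive at `p` with `E[p]`
irreducible, `(G)`-ordinary, `(p = 5 ∧ v₅(Δ_min) = 3) ∨ (p = 7 ∧ v₇(Δ_min) = 2)` (Kodaira III at `5` /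
II at `7`: semistability defect `e = p − 1`) AND carrying a `ℚ_p`-rational point of order `p`, then the whole
principal-series cell at `p ∈ {5, 7}` holds: off that sub-cell `W(ℚ_p)[p] = 0`
(`TypeG.padicValInt_of_prime_zsmul_eq_zero`) and `cell57_of_kato57_of_noPTorsion` applies.
[cite: Mazur1977, Ch. III §5, Step 1, p. 158] [cite: KostersPannekoek2017, Cor. 2] -/
theorem cellPS57_of_kato57_of_corner (hK : kato_neron_isIntegral_twistedSymbolSum_of_additive_five_le)
    (hcorner : ∀ (W : WeierstrassCurve ℚ) [W.IsElliptic] [W.IsGloballyMinimal] (p : ℕ) [Fact p.Prime]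
      [NeZero (W.conductorNorm ℤ)] (D : ModularParametrizationData W (W.conductorNorm ℤ)),
      ((p = 5 ∧ padicValInt p W.minimalDiscriminantInt = 3) ∨
        (p = 7 ∧ padicValInt p W.minimalDiscriminantInt = 2)) →
      Addv W p → Irr W p → TypeGOrd W p →
      (∃ P : (W.baseChange ℚ_[p]).toAffine.Point, p • P = 0 ∧ P ≠ 0) →
      (∀ z ∈ D.L.lattice, ∃ w ∈ periodLattice D.f, z = D.c * w) → ¬ (p : ℤ) ∣ D.c) :
    ∀ (W : WeierstrassCurve ℚ) [W.IsElliptic] [W.IsGloballyMinimal] (p : ℕ) [Fact p.Prime]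
      [NeZero (W.conductorNorm ℤ)] (D : ModularParametrizationData W (W.conductorNorm ℤ)),
      (p = 5 ∨ p = 7) → Addv W p → Irr W p → TypeGOrd W p →
      (∀ n : ℕ, W.kodairaSymbolAt (placeOf p) ≠ .Istar n) →
      (∀ z ∈ D.L.lattice, ∃ w ∈ periodLattice D.f, z = D.c * w) → ¬ (p : ℤ) ∣ D.c := by
  intro W _ _ p _ _ D hp57 hadd hirr hG _ hlat
  have hp5 : 5 ≤ p := by rcases hp57 with rfl | rfl <;> omega
  by_cases hPT : ∀ P : (W.baseChange ℚ_[p]).toAffine.Point, p • P = 0 → P = 0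
  · exact cell57_of_kato57_of_noPTorsion hK W p D hp57 hadd hirr hPT hlat
  · push Not at hPT
    obtain ⟨P, hP, hP0⟩ := hPT
    have hv := hG.typeG.padicValInt_of_prime_zsmul_eq_zero hp5 hadd hP0 (by rw [natCast_zsmul]; exact hP)
    exact hcorner W p D hv hadd hirr hG ⟨P, hP, hP0⟩ hlat

/-! ### (SC57): only the low-discriminant types with a local `p`-torsion point remain -/

/-- **(SC57) from its low-discriminant sub-cell, granted Kato's fact F″.** If `p ∤ c(D)` holds for every
globally minimal `W` with a lattice-optimal conductor-level datum `D`, additive at `p` with `E[p]`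
irreducible, NOT `(G)`-ordinary, `(p = 5 ∧ v₅(Δ_min) ∈ {2, 3}) ∨ (p = 7 ∧ v₇(Δ_min) = 2)` AND carrying a
`ℚ_p`-rational point of order `p`, then the whole supercuspidal cell at `p ∈ {5, 7}` holds
(`padicValInt_minimalDiscriminantInt_of_prime_zsmul_eq_zero_of_addv` + `cell57_of_kato57_of_noPTorsion`).
(Of the three, only Kodaira II at `5` is potentially supersingular; recorded, not used.)
[cite: Mazur1977, Ch. III §5, Step 1, p. 158] [cite: KostersPannekoek2017, Cor. 2] -/
theorem cellSC57_of_kato57_of_lowDiscriminant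
    (hK : kato_neron_isIntegral_twistedSymbolSum_of_additive_five_le)
    (hlow : ∀ (W : WeierstrassCurve ℚ) [W.IsElliptic] [W.IsGloballyMinimal] (p : ℕ) [Fact p.Prime]
      [NeZero (W.conductorNorm ℤ)] (D : ModularParametrizationData W (W.conductorNorm ℤ)),
      ((p = 5 ∧ (padicValInt p W.minimalDiscriminantInt = 2 ∨ padicValInt p W.minimalDiscriminantInt = 3)) ∨
        (p = 7 ∧ padicValInt p W.minimalDiscriminantInt = 2)) →
      Addv W p → Irr W p → ¬ TypeGOrd W p →
      (∃ P : (W.baseChange ℚ_[p]).toAffine.Point, p • P = 0 ∧ P ≠ 0) →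
      (∀ z ∈ D.L.lattice, ∃ w ∈ periodLattice D.f, z = D.c * w) → ¬ (p : ℤ) ∣ D.c) :
    ∀ (W : WeierstrassCurve ℚ) [W.IsElliptic] [W.IsGloballyMinimal] (p : ℕ) [Fact p.Prime]
      [NeZero (W.conductorNorm ℤ)] (D : ModularParametrizationData W (W.conductorNorm ℤ)),
      (p = 5 ∨ p = 7) → Addv W p → Irr W p → ¬ TypeGOrd W p →
      (∀ n : ℕ, W.kodairaSymbolAt (placeOf p) ≠ .Istar n) →
      (∀ z ∈ D.L.lattice, ∃ w ∈ periodLattice D.f, z = D.c * w) → ¬ (p : ℤ) ∣ D.c := by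
  intro W _ _ p _ _ D hp57 hadd hirr hG _ hlat
  have hp5 : 5 ≤ p := by rcases hp57 with rfl | rfl <;> omega
  by_cases hPT : ∀ P : (W.baseChange ℚ_[p]).toAffine.Point, p • P = 0 → P = 0
  · exact cell57_of_kato57_of_noPTorsion hK W p D hp57 hadd hirr hPT hlat
  · push Not at hPT
    obtain ⟨P, hP, hP0⟩ := hPT
    have hv := padicValInt_minimalDiscriminantInt_of_prime_zsmul_eq_zero_of_addv W p hp5 hadd hP0
      (by rw [natCast_zsmul]; exact hP)
    exact hlow W p D hv hadd hirr hG ⟨P, hP, hP0⟩ hlat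

/-! ### The cruxes from (PS≥11), F″ and the two sub-cells -/

/-- **PSMU ⟸ Edixhoven's Kodaira fact + Modularity + (PS≥11) + F″ + the Raynaud-corner sub-cell.**
[cite: EdixhovenManin1991, Thm. 3] [cite: Mazur1977, Ch. III §5, Step 1] -/
theorem principalSeriesOptimalManinUnit_of_cellPS11_of_kato57_of_corner
    (hEdxK : edixhoven_not_dvd_maninConstant_of_kodairaSymbol_ne) (hnf : exists_isNewformOf)
    (hK : kato_neron_isIntegral_twistedSymbolSum_of_additive_five_le)
    (h11 : ∀ (W : WeierstrassCurve ℚ) [W.IsElliptic] [W.IsGloballyMinimal] (p : ℕ) [Fact p.Prime]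
      [NeZero (W.conductorNorm ℤ)] (D : ModularParametrizationData W (W.conductorNorm ℤ)),
      11 ≤ p → Addv W p → Irr W p → TypeGOrd W p → padicValInt p W.minimalDiscriminantInt ≤ 4 →
      (∀ z ∈ D.L.lattice, ∃ w ∈ periodLattice D.f, z = D.c * w) → ¬ (p : ℤ) ∣ D.c)
    (hcorner : ∀ (W : WeierstrassCurve ℚ) [W.IsElliptic] [W.IsGloballyMinimal] (p : ℕ) [Fact p.Prime]
      [NeZero (W.conductorNorm ℤ)] (D : ModularParametrizationData W (W.conductorNorm ℤ)),
      ((p = 5 ∧ padicValInt p W.minimalDiscriminantInt = 3) ∨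
        (p = 7 ∧ padicValInt p W.minimalDiscriminantInt = 2)) →
      Addv W p → Irr W p → TypeGOrd W p →
      (∃ P : (W.baseChange ℚ_[p]).toAffine.Point, p • P = 0 ∧ P ≠ 0) →
      (∀ z ∈ D.L.lattice, ∃ w ∈ periodLattice D.f, z = D.c * w) → ¬ (p : ℤ) ∣ D.c) :
    PrincipalSeriesOptimalManinUnit :=
  principalSeriesOptimalManinUnit_of_cells hEdxK hnf h11 (cellPS57_of_kato57_of_corner hK hcorner)

/-- **SCMU57 ⟸ Modularity + F″ + the low-discriminant sub-cell.** [cite: Mazur1977, Ch. III §5, Step 1] -/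
theorem supercuspidalOptimalManinUnitFiveSeven_of_kato57_of_lowDiscriminant (hnf : exists_isNewformOf)
    (hK : kato_neron_isIntegral_twistedSymbolSum_of_additive_five_le)
    (hlow : ∀ (W : WeierstrassCurve ℚ) [W.IsElliptic] [W.IsGloballyMinimal] (p : ℕ) [Fact p.Prime]
      [NeZero (W.conductorNorm ℤ)] (D : ModularParametrizationData W (W.conductorNorm ℤ)),
      ((p = 5 ∧ (padicValInt p W.minimalDiscriminantInt = 2 ∨ padicValInt p W.minimalDiscriminantInt = 3)) ∨
        (p = 7 ∧ padicValInt p W.minimalDiscriminantInt = 2)) →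
      Addv W p → Irr W p → ¬ TypeGOrd W p →
      (∃ P : (W.baseChange ℚ_[p]).toAffine.Point, p • P = 0 ∧ P ≠ 0) →
      (∀ z ∈ D.L.lattice, ∃ w ∈ periodLattice D.f, z = D.c * w) → ¬ (p : ℤ) ∣ D.c) :
    SupercuspidalOptimalManinUnitFiveSeven :=
  supercuspidalOptimalManinUnitFiveSeven_of_cell hnf (cellSC57_of_kato57_of_lowDiscriminant hK hlow)

end Summit.BirchSwinnertonDyer.BirchSwinnertonDyer.Theorems.TeichmullerTwistDescent

end
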